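import Summits.KontsevichZagierPeriods.Zeta5Search.TwoTaleOmega.StepEL
import Summits.KontsevichZagierPeriods.Zeta5Search.TwoTaleOmega.CertAtomsF
import Summits.KontsevichZagierPeriods.Zeta5Search.Certificates.TwoTaleTelescopeLeading

/-!
# (bmiss)@Ω — the recurrence in direction `f`, FIRST TALE (cell `pub-zeta5`, cert-1 gen 4)

HONEST FRAMING: systematic search; recurrence certificates; no irrationality claim unless certified. Pure finite algebra
over `ℚ`; no named fact, no `sorry`.

Blueprint `families/tele/RECURRENCE.md` §13.10–13.12, direction `δ = f = (0,0,0,1,0)`, side `L`; the mirror of `StepEL` under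
`e ↔ f`. INPUT: cert-2's `Certificates.TwoTaleTelescope.telescope_f_L` (`Cert_L = t(t+a−e)(t+a−f)(t+g−1)·x_L(t)`, `x_L` the cubic
`xPolyFL`; atoms opaque, `CertAtomsF`). Along `δ_f` the numerator blocks `[a−e+1,f)` and `[a−f+1,b)` move:
`num(p+kδ) = num(p)·block(f,f+k)·block(a−f−k+1,a−f+1)`; denominator, `t`-shift and node window as in `StepBL`/`OmegaRegion`.
`GfFL = ofFrac [a,g) 1 (block(0,e)·block(a−e,f)·block(a−f,b)·(X+g−1)·x_L)`; legitimacy at `s* = node(p)`, node moves through the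
double-zero window. OUTPUT `recL_f`; `c^f_3(p) = (a−b−2e−2f+g−4)(a−b−2e−2f+g−3) ≠ 0` on Ω (`TwoTaleTelescopeLeading.cF3_eq`).
-/

noncomputable section

open Finset Polynomial
open Literature.NumberTheory.Irrationality.Zudilin2014
open Summit.KontsevichZagierPeriods.Zeta5Search.FormalBarnes
open Summit.KontsevichZagierPeriods.Zeta5Search.Certificates.TwoTaleTelescope

namespace Summit.KontsevichZagierPeriods.Zeta5Search.TwoTaleOmega

namespace Pt

variable (p : Pt)

/-! ### The telescoper of direction `f` at a point -/

/-- cert-2's telescoper coefficients `c^f_0..c^f_3` of direction `f`, evaluated at `p`. -/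
def coefF : Fin 4 → ℚ :=
  ![spvalC Certificates.TwoTaleTelescope.cF0 (p.a : ℚ) p.b p.e p.f p.g,
    spvalC Certificates.TwoTaleTelescope.cF1 (p.a : ℚ) p.b p.e p.f p.g,
    spvalC Certificates.TwoTaleTelescope.cF2 (p.a : ℚ) p.b p.e p.f p.g,
    spvalC Certificates.TwoTaleTelescope.cF3 (p.a : ℚ) p.b p.e p.f p.g]

/-- The leading coefficient in closed form: `c^f_3(p) = (a−b−2e−2f+g−4)(a−b−2e−2f+g−3)`. -/
theorem coefF_three : p.coefF 3 = ((p.a : ℚ) - p.b - 2 * p.e - 2 * p.f + p.g - 4) * ((p.a : ℚ) - p.b - 2 * p.e - 2 * p.f + p.g - 3) := by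
  show spvalC Certificates.TwoTaleTelescope.cF3 (p.a : ℚ) p.b p.e p.f p.g = _
  rw [cF3_eq]; ring

variable {p}

/-- On Ω the leading coefficient does not vanish (both linear factors are `≤ −2`, so the product is positive). -/
theorem coefF_three_ne_zero (h : p.Omega) : p.coefF 3 ≠ 0 := by
  rw [coefF_three]
  have := h.g_le
  have h1 : ((p.a : ℚ) - p.b - 2 * p.e - 2 * p.f + p.g - 4) = ((p.a - p.b - 2 * p.e - 2 * p.f + p.g - 4 : ℤ) : ℚ) := by push_cast; ring
  have h2 : ((p.a : ℚ) - p.b - 2 * p.e - 2 * p.f + p.g - 3) = ((p.a - p.b - 2 * p.e - 2 * p.f + p.g - 3 : ℤ) : ℚ) := by push_cast; ring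
  rw [h1, h2]
  exact mul_ne_zero (by exact_mod_cast (by omega : (p.a - p.b - 2 * p.e - 2 * p.f + p.g - 4 : ℤ) ≠ 0))
    (by exact_mod_cast (by omega : (p.a - p.b - 2 * p.e - 2 * p.f + p.g - 3 : ℤ) ≠ 0))

/-! ### Block algebra along `δ_f` -/

variable (p)

/-- Along `δ_f` the blocks `[a−e+1,f)` and `[a−f+1,b)` move: `num(p+kδ) = num(p)·block(f,f+k)·block(a−f−k+1,a−f+1)` (`k ≥ 0`, `p ∈ Ω`). -/
theorem num_addF_eq (h : p.Omega) {k : ℤ} (hk : 0 ≤ k) :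
    num (p.addF k).t1a (p.addF k).t1b = num p.t1a p.t1b * (block p.f (p.f + k) * block (p.a - p.f - k + 1) (p.a - p.f + 1)) := by
  have := h.b_ge; have := h.f_le; have := h.e_le; have := h.twoE; have := h.twoF; have := h.pos
  rw [num_t1, num_t1]
  simp only [addF_a, addF_b, addF_e, addF_f]
  rw [← block_mul_block (lo := p.a - p.e + 1) (mi := p.f) (hi := p.f + k) (by omega) (by omega),
    show p.a - (p.f + k) + 1 = p.a - p.f - k + 1 by ring,
    ← block_mul_block (lo := p.a - p.f - k + 1) (mi := p.a - p.f + 1) (hi := p.b) (by omega) (by omega)]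
  ring

/-- Along `δ_f` the denominator does not move. -/
theorem den_addF (k : ℤ) : den (p.addF k).t1a (p.addF k).t1b = den p.t1a p.t1b := rfl

/-! ### The telescoped function `G = Cert_L · F_L(p;·)` as closed-form data -/

/-- Numerator of `G_{f,L}`: the merged blocks of `StepBL.NfBL` times the cubic `x_L`. -/
def NfFL : ℚ[X] := p.NfBL * xPolyFL (p.a : ℚ) p.b p.e p.f p.g

/-- Degree bound of `N_G`. -/
theorem natDegree_NfFL_le :
    p.NfFL.natDegree ≤ (p.e).toNat + (p.f - (p.a - p.e)).toNat + (p.b - (p.a - p.f)).toNat + 1 + 3 := by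
  unfold NfFL
  refine (natDegree_mul_le).trans (Nat.add_le_add (natDegree_NfBL p).le (natDegree_xPolyFL_le _ _ _ _ _))

/-- **The telescoped data** `G_{f,L}(p) = ofFrac [a,g) 1 (N_G)`. -/
def GfFL : PF := PF.ofFrac (Ico p.a p.g) (fun _ => 1) p.NfFL

/-- The poles of `G_{f,L}` lie in `[a,g)`. -/
theorem poles_GfFL : p.GfFL.poles ⊆ Ico p.a p.g := PF.poles_ofFrac _ _ _

/-- `x_L` at `t` and at `t+1` are cert-2's atoms `polyTN xFL 0/1`. -/
theorem eval_xPolyFL_zero_one (a b e f g t : ℚ) : (xPolyFL a b e f g).eval t = polyTN xFL 0 a b e f g t ∧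
    (xPolyFL a b e f g).eval (t + 1) = polyTN xFL 1 a b e f g t := by
  refine ⟨?_, ?_⟩
  · have := eval_xPolyFL 0 a b e f g t; push_cast at this; rwa [add_zero] at this
  · have := eval_xPolyFL 1 a b e f g t; push_cast at this; exact this

/-- Value of `G_{f,L}`: `t(t+a−e)(t+a−f)(t+g−1)·x_L(t)·num(t)/den(t)` off the poles. -/
theorem GfFL_eval (h : p.Omega) {t : ℚ} (ht : ∀ k ∈ Ico p.a p.g, t + k ≠ 0) :
    p.GfFL.eval t = t * (t + (p.a - p.e : ℤ)) * (t + (p.a - p.f : ℤ)) * (t + (p.g - 1 : ℤ))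
      * (xPolyFL (p.a : ℚ) p.b p.e p.f p.g).eval t * ((num p.t1a p.t1b).eval t / (den p.t1a p.t1b).eval t) := by
  unfold GfFL NfFL
  rw [PF.eval_ofFrac _ _ _ (fun _ _ => Or.inl rfl) ht, denom_Ico_one, NfBL_eq p h, den_t1]
  simp only [eval_mul, eval_lin]
  push_cast; ring

/-- Degree of the polynomial part of `G_{f,L}`: `≤ d + 7 ≤ d⁺ + 10`. -/
theorem natDegree_GfFL_le (h : p.Omega) : p.GfFL.poly.natDegree ≤ dExp p.t1a p.t1b + 10 := by
  unfold GfFL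
  have hN := natDegree_NfFL_le p
  rw [PF.natDegree_ofFrac, sum_const, Int.card_Ico, smul_eq_mul, mul_one]
  unfold dExp; rw [sum_t1a_sub_sum_t1b]; unfold dInt
  obtain ⟨h1, h2, h3, h4, h5, h6, h7, h8, h9⟩ := h
  omega

/-! ### Step (2): the function identity -/

variable {p}

set_option maxHeartbeats 1600000 in
/-- **Function identity** `Σ_k c^f_k(p) F_L(p+kδ_f;t) = G(t+1) − G(t)` off the exceptional set `SbL` (the same as for `b`). -/
theorem funId_fL (h0 : p.Omega) (h1 : (p.addF 1).Omega) (h2 : (p.addF 2).Omega) (h3 : (p.addF 3).Omega) {t : ℚ}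
    (ht : ∀ k ∈ p.SbL, t + k ≠ 0) :
    p.coefF 0 * p.vL.eval t + p.coefF 1 * (p.addF 1).vL.eval t + p.coefF 2 * (p.addF 2).vL.eval t
      + p.coefF 3 * (p.addF 3).vL.eval t = p.GfFL.eval (t + 1) - p.GfFL.eval t := by
  have o := h0
  obtain ⟨o1, o2, o3, o4, o5, o6, o7, o8, o9⟩ := h0
  have hS : ∀ k ∈ Ico p.a p.g, t + k ≠ 0 := fun k hk => ht k (by
    unfold SbL; rw [mem_union]; left; rw [mem_Ico] at hk ⊢; omega)
  have hS1 : ∀ k ∈ Ico p.a p.g, t + 1 + k ≠ 0 := fun k hk => by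
    have := ht (k + 1) (by unfold SbL; rw [mem_union]; left; rw [mem_Ico] at hk ⊢; omega)
    push_cast at this
    rwa [add_assoc, add_comm (1:ℚ)]
  have hg : t + p.g ≠ 0 := ht p.g (by unfold SbL; rw [mem_union]; left; rw [mem_Ico]; omega)
  have h1' : t + 1 ≠ 0 := by
    have := ht 1 (by unfold SbL; rw [mem_union]; right; simp)
    push_cast at this; exact this
  have hae : t + (p.a - p.e + 1 : ℤ) ≠ 0 := ht _ (by unfold SbL; rw [mem_union]; right; simp)
  have haf : t + (p.a - p.f + 1 : ℤ) ≠ 0 := ht _ (by unfold SbL; rw [mem_union]; right; simp)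
  push_cast at hae haf
  -- the four values and the shift
  set F0 := p.vL.eval t with hF0
  set F0' := p.vL.eval (t + 1) with hF0'
  have eN : (num p.t1a p.t1b).eval t / (den p.t1a p.t1b).eval t = F0 := (vL_eval_w o hS).symm
  have b1 := eval_block_123 p.f t
  have c1 := (eval_block_123 (p.a - p.f) t).1
  have c2 := (eval_block_123 (p.a - p.f - 1) t).2.1
  have c3 := (eval_block_123 (p.a - p.f - 2) t).2.2
  rw [show p.a - p.f - 1 + 2 = p.a - p.f + 1 by ring] at c2
  rw [show p.a - p.f - 2 + 3 = p.a - p.f + 1 by ring] at c3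
  have eF1 : (p.addF 1).vL.eval t = lprod numFL1 (p.a : ℚ) p.b p.e p.f p.g t * F0 := by
    rw [vL_eval_w h1 hS, num_addF_eq p o (by norm_num), den_addF, eval_mul, eval_mul, b1.1,
      show p.a - p.f - 1 + 1 = p.a - p.f by ring, c1, ← eN, numFL1_eval]; push_cast; ring
  have eF2 : (p.addF 2).vL.eval t = lprod numFL2 (p.a : ℚ) p.b p.e p.f p.g t * F0 := by
    rw [vL_eval_w h2 hS, num_addF_eq p o (by norm_num), den_addF, eval_mul, eval_mul, b1.2.1,
      show p.a - p.f - 2 + 1 = p.a - p.f - 1 by ring, c2, ← eN, numFL2_eval]; push_cast; ring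
  have eF3 : (p.addF 3).vL.eval t = lprod numFL3 (p.a : ℚ) p.b p.e p.f p.g t * F0 := by
    rw [vL_eval_w h3 hS, num_addF_eq p o (by norm_num), den_addF, eval_mul, eval_mul, b1.2.2,
      show p.a - p.f - 3 + 1 = p.a - p.f - 2 by ring, c3, ← eN, numFL3_eval]; push_cast; ring
  have hshift := vL_shift o hS hS1
  rw [← hF0, ← hF0'] at hshift
  push_cast at hshift
  -- the values of G
  have ex := eval_xPolyFL_zero_one (p.a : ℚ) p.b p.e p.f p.g t
  have eG0 : p.GfFL.eval t = t * (t + (p.a - p.e : ℤ)) * (t + (p.a - p.f : ℤ)) * (t + (p.g - 1 : ℤ))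
      * polyTN xFL 0 (p.a : ℚ) p.b p.e p.f p.g t * F0 := by
    rw [GfFL_eval p o hS, eN, ex.1]
  have eG1 : p.GfFL.eval (t + 1)
      = (t + 1) * (t + 1 + (p.a - p.e : ℤ)) * (t + 1 + (p.a - p.f : ℤ)) * (t + 1 + (p.g - 1 : ℤ))
        * polyTN xFL 1 (p.a : ℚ) p.b p.e p.f p.g t * F0' := by
    rw [GfFL_eval p o hS1, hF0', vL_eval_w o hS1, ex.2]
  -- cert-2's cleared identity, atoms opaque
  have hc := telescope_f_L (p.a : ℚ) p.b p.e p.f p.g t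
  simp only [numFL0, denFL0, denFL1, denFL2, denFL3, cdenFL, cdenSFL, lprod_nil, mul_one, one_mul] at hc
  have c0 : p.coefF 0 = spvalC Certificates.TwoTaleTelescope.cF0 (p.a : ℚ) p.b p.e p.f p.g := rfl
  have c1' : p.coefF 1 = spvalC Certificates.TwoTaleTelescope.cF1 (p.a : ℚ) p.b p.e p.f p.g := rfl
  have c2' : p.coefF 2 = spvalC Certificates.TwoTaleTelescope.cF2 (p.a : ℚ) p.b p.e p.f p.g := rfl
  have c3' : p.coefF 3 = spvalC Certificates.TwoTaleTelescope.cF3 (p.a : ℚ) p.b p.e p.f p.g := rfl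
  have htd : lprod tdFL (p.a : ℚ) p.b p.e p.f p.g t ≠ 0 := by
    rw [tdFL_eval]
    exact mul_ne_zero (mul_ne_zero (mul_ne_zero (fun h => h1' (by linarith)) (fun h => hae (by linarith)))
      (fun h => haf (by linarith))) (fun h => hg (by linarith))
  have key := telescope_assembly (F0 := F0) (F0' := F0')
    (F1 := (p.addF 1).vL.eval t) (F2 := (p.addF 2).vL.eval t) (F3 := (p.addF 3).vL.eval t)
    (c0 := p.coefF 0) (c1 := p.coefF 1) (c2 := p.coefF 2) (c3 := p.coefF 3) (s1 := 1) (s2 := 1) (s3 := 1)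
    (n1 := lprod numFL1 (p.a : ℚ) p.b p.e p.f p.g t) (n2 := lprod numFL2 (p.a : ℚ) p.b p.e p.f p.g t)
    (n3 := lprod numFL3 (p.a : ℚ) p.b p.e p.f p.g t) (d1 := 1) (d2 := 1) (d3 := 1)
    (tn := lprod tnFL (p.a : ℚ) p.b p.e p.f p.g t) (td := lprod tdFL (p.a : ℚ) p.b p.e p.f p.g t)
    (cnum := lprod cnumFL (p.a : ℚ) p.b p.e p.f p.g t) (cnumS := lprod cnumSFL (p.a : ℚ) p.b p.e p.f p.g t)
    (cden := 1) (cdenS := 1) (x0 := polyTN xFL 0 (p.a : ℚ) p.b p.e p.f p.g t) (x1 := polyTN xFL 1 (p.a : ℚ) p.b p.e p.f p.g t)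
    (by rw [eF1]; ring) (by rw [eF2]; ring) (by rw [eF3]; ring)
    (by rw [tdFL_eval, tnFL_eval]; linear_combination hshift)
    one_ne_zero one_ne_zero one_ne_zero htd one_ne_zero one_ne_zero
    (by rw [c0, c1', c2', c3']; linear_combination hc)
  rw [eG1, eG0, key, cnumSFL_eval, cnumFL_eval]
  push_cast
  ring

/-! ### Step (3): the DATA identity -/

/-- **Data identity** `Σ_k c^f_k(p)·vL(p+kδ_f) = S G − G` (Lemma U over `SbL`). -/
theorem dataId_fL (h0 : p.Omega) (h1 : (p.addF 1).Omega) (h2 : (p.addF 2).Omega) (h3 : (p.addF 3).Omega) :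
    PF.comb4 p.coefF ![p.vL, (p.addF 1).vL, (p.addF 2).vL, (p.addF 3).vL] = p.GfFL.shift.add (p.GfFL.smul (-1)) := by
  have hIco : Ico p.a p.g ⊆ p.SbL := fun k hk => by
    unfold SbL; rw [mem_union]; left; rw [mem_Ico] at hk ⊢; omega
  have hvk : ∀ q : Pt, q.Omega → q.a = p.a → q.g = p.g → q.vL.poles ⊆ p.SbL := fun q hq hqa hqg => by
    refine (poles_vL q).trans (Subset.trans (Ico_subset_Ico ?_ ?_) hIco)
    · rw [amax_t1a_eq, hqa]; have := hq.e_le; have := hq.f_le; omega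
    · rw [hqg]
  refine PF.eq_of_eval_eq_on _ _ p.SbL ?_ ?_ fun t ht => ?_
  · refine (PF.poles_comb4_subset _ _).trans (union_subset (union_subset ?_ ?_) (union_subset ?_ ?_)) <;>
      simp only [Matrix.cons_val_zero, Matrix.cons_val_one, Matrix.cons_val_two, Matrix.cons_val_three,
        Matrix.head_cons, Matrix.tail_cons]
    · exact hvk p h0 rfl rfl
    · exact hvk _ h1 rfl rfl
    · exact hvk _ h2 rfl rfl
    · exact hvk _ h3 rfl rfl
  · refine (PF.poles_shift_sub_subset _).trans (union_subset ?_ ((poles_GfFL p).trans hIco))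
    intro k hk
    obtain ⟨j, hj, rfl⟩ := mem_image.1 hk
    have hj' := poles_GfFL p hj
    unfold SbL; rw [mem_union]; left; rw [mem_Ico] at hj' ⊢; omega
  · rw [PF.eval_comb4, PF.eval_shift_sub, Fin.sum_univ_four]
    simp only [Matrix.cons_val_zero, Matrix.cons_val_one, Matrix.cons_val_two, Matrix.cons_val_three,
      Matrix.head_cons, Matrix.tail_cons]
    exact funId_fL h0 h1 h2 h3 ht

/-! ### Step (4): legitimacy at the common node `s* = node(p)` -/

/-- `ρ⁰_{s*}(G) = ρ¹_{s*}(G) = 0` at the node of `p` (double zero of the merged blocks; the cubic `x_L` only adds zeros). -/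
theorem GfFL_rho (h : p.Omega) : rho0 p.nodeL p.GfFL = 0 ∧ rho1 p.nodeL p.GfFL = 0 := by
  have sp := a2star_t1a_eq h
  obtain ⟨o1, o2, o3, o4, o5, o6, o7, o8, o9⟩ := h
  set m := a2star p.t1a with hm
  have hnode : p.nodeL = -(m - 1) := by unfold nodeL; ring
  have hc : m - 1 ∉ Ico p.a p.g := by rw [mem_Ico]; omega
  rw [hnode]
  refine ⟨PF.rho0_ofFrac_eq_zero _ _ _ (fun _ _ => Or.inl rfl) hc ?_, PF.rho1_ofFrac_eq_zero _ _ _ hc⟩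
  have hcases : (0 ≤ m - 1 ∧ m - 1 < p.e ∧ p.a - p.e ≤ m - 1 ∧ m - 1 < p.f)
      ∨ (0 ≤ m - 1 ∧ m - 1 < p.e ∧ p.a - p.f ≤ m - 1 ∧ m - 1 < p.b)
      ∨ (p.a - p.e ≤ m - 1 ∧ m - 1 < p.f ∧ p.a - p.f ≤ m - 1 ∧ m - 1 < p.b) := by omega
  unfold NfFL NfBL
  refine Dvd.dvd.mul_right ?_ _
  rcases hcases with ⟨a1, a2, a3, a4⟩ | ⟨a1, a2, a3, a4⟩ | ⟨a1, a2, a3, a4⟩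
  · exact (pow_two (lin (m - 1)) ▸ mul_dvd_mul (lin_dvd_block a1 a2) (lin_dvd_block a3 a4)).mul_right _
      |>.mul_right _
  · refine (pow_two (lin (m - 1)) ▸ mul_dvd_mul (lin_dvd_block a1 a2) (lin_dvd_block a3 a4)).trans ?_
    exact ⟨block (p.a - p.e) p.f * lin (p.g - 1), by ring⟩
  · refine (pow_two (lin (m - 1)) ▸ mul_dvd_mul (lin_dvd_block a1 a2) (lin_dvd_block a3 a4)).trans ?_
    exact ⟨block 0 p.e * lin (p.g - 1), by ring⟩

/-! ### Step (5): node moves -/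

set_option maxHeartbeats 2000000 in
/-- Along `δ_f` (`k ≥ 0`) the own node of `p+kδ` lies left of `s* = node(p)` and `F_L(p+kδ;·)` has a double zero at every
lattice point in between. -/
theorem lam_nodes_fL (h0 : p.Omega) {k : ℤ} (hk0 : 0 ≤ k) (hk : (p.addF k).Omega) (D : ℕ)
    (hD : (p.addF k).vL.poly.natDegree ≤ D) :
    lam0 D (p.addF k).nodeL (p.addF k).vL = lam0 D p.nodeL (p.addF k).vL ∧
      lam1 (p.addF k).nodeL (p.addF k).vL = lam1 p.nodeL (p.addF k).vL := by
  have sp := a2star_t1a_lin h0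
  have spk := a2star_t1a_lin hk
  simp only [addF_b, addF_e, addF_f] at spk
  obtain ⟨o1, o2, o3, o4, o5, o6, o7, o8, o9⟩ := h0
  have hle : a2star p.t1a ≤ a2star (p.addF k).t1a := by omega
  obtain ⟨n, hn⟩ : ∃ n : ℕ, a2star (p.addF k).t1a = a2star p.t1a + n :=
    ⟨(a2star (p.addF k).t1a - a2star p.t1a).toNat, by rw [Int.toNat_of_nonneg (sub_nonneg.2 hle)]; ring⟩
  have hn0 : p.nodeL = 1 - a2star p.t1a := rfl
  have hnk : (p.addF k).nodeL = 1 - a2star (p.addF k).t1a := rfl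
  have hs : p.nodeL = (p.addF k).nodeL + n := by rw [hn0, hnk, hn]; ring
  rw [hs]
  have hek := hk.f_le; rw [addF_a, addF_f] at hek
  have ha : -(p.addF k).nodeL < (p.addF k).a := by rw [addF_a, hnk]; omega
  refine (lam_vL_move hk _ n D hD ha fun i hi => ?_).imp Eq.symm Eq.symm
  refine sq_lin_dvd_num hk ?_ ?_
  · rw [addF_a, addF_e, addF_f, hnk]; omega
  · rw [hnk]; omega

/-! ### Step (6): the first-tale recurrence of direction `f` -/

/-- **Direction `e`, first tale.** For `p, p+δ, p+2δ, p+3δ ∈ Ω` (`δ = δ_f`):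
`Σ_k c^f_k(p)·Λ¹_{node(p+kδ)}[vL(p+kδ)] = 0` and the same for `Λ⁰` with the common truncation `D = d⁺(p) + 10`. -/
theorem recL_f (h0 : p.Omega) (h1 : (p.addF 1).Omega) (h2 : (p.addF 2).Omega) (h3 : (p.addF 3).Omega) :
    (p.coefF 0 * lam1 p.nodeL p.vL + p.coefF 1 * lam1 (p.addF 1).nodeL (p.addF 1).vL
      + p.coefF 2 * lam1 (p.addF 2).nodeL (p.addF 2).vL + p.coefF 3 * lam1 (p.addF 3).nodeL (p.addF 3).vL = 0) ∧
    (p.coefF 0 * lam0 (dExp p.t1a p.t1b + 10) p.nodeL p.vL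
      + p.coefF 1 * lam0 (dExp p.t1a p.t1b + 10) (p.addF 1).nodeL (p.addF 1).vL
      + p.coefF 2 * lam0 (dExp p.t1a p.t1b + 10) (p.addF 2).nodeL (p.addF 2).vL
      + p.coefF 3 * lam0 (dExp p.t1a p.t1b + 10) (p.addF 3).nodeL (p.addF 3).vL = 0) := by
  set D := dExp p.t1a p.t1b + 10 with hDdef
  have hdata := dataId_fL h0 h1 h2 h3
  have hrho := GfFL_rho h0
  have hDk : ∀ q : Pt, q.Omega → q.a = p.a → q.b = p.b → q.e = p.e → q.g = p.g → q.f ≤ p.f + 3 →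
      q.vL.poly.natDegree ≤ D := fun q hq qa qb qe qg qf => by
    refine (vL_natDegree_le_w hq).trans ?_
    rw [hDdef]; unfold dExp; rw [sum_t1a_sub_sum_t1b, sum_t1a_sub_sum_t1b]; unfold dInt
    rw [qa, qb, qe, qg]; omega
  have hD1 := hDk _ h1 rfl rfl rfl rfl (by simp)
  have hD2 := hDk _ h2 rfl rfl rfl rfl (by simp)
  have hD3 := hDk _ h3 rfl rfl rfl rfl (by simp)
  have m1 := lam_nodes_fL h0 (by norm_num) h1 D hD1
  have m2 := lam_nodes_fL h0 (by norm_num) h2 D hD2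
  have m3 := lam_nodes_fL h0 (by norm_num) h3 D hD3
  have s1 := lam1_step p.nodeL p.coefF _ p.GfFL hdata
  have s0 := lam0_step D p.nodeL p.coefF _ p.GfFL hdata (natDegree_GfFL_le p h0)
  rw [Fin.sum_univ_four] at s1 s0
  simp only [Matrix.cons_val_zero, Matrix.cons_val_one, Matrix.cons_val_two, Matrix.cons_val_three,
    Matrix.head_cons, Matrix.tail_cons] at s1 s0
  rw [hrho.2] at s1
  rw [hrho.1] at s0
  rw [m1.2, m2.2, m3.2, m1.1, m2.1, m3.1]
  exact ⟨s1, s0⟩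

end Pt

end Summit.KontsevichZagierPeriods.Zeta5Search.TwoTaleOmega

end
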